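import Summits.CriticalPhenomena.PercolationContinuityZ3.Theorems.PercNearOneGluingNoHeavyLowerTailSahiAllOrdersSquarefree
import Summits.CriticalPhenomena.PercolationContinuityZ3.Theorems.PercNearOneGluingNoHeavyLowerTailSahiMixtureLawCells

/-!
# Sahi positivity under CONVOLUTION (law level): member-wise unions and intersections of two INDEPENDENT all-orders-positive families —
# two members: both closures hold; three members: the INTERSECTION closure is FALSE (exact counterexample); the reduction to one row per order

Support file of the one-cut programme (crux `NoHeavyLowerTail`, stmt-CriticalPhenomena-4575; cell `prim-masterthm`, seat P3, gen 5;
`run/shared/lean/prim/prim-masterthm/prim-masterthm-p3/HIERARCHY.md` §12).  Vocabulary: `…SahiMixtureLaw` (`AllOrders`), `…SahiAllOrdersSquarefree`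
(`allOrders_iff_squarefree`: all orders ⟺ square-free rows, any measure; `allOrders_three_of_rows`).

SETTING.  Two probability weights `μ` on `α` and `ν` on `β`, the product weight `prodWeight μ ν` on `α × β` (independent coupling), families of events
`A : Fin n → Set α`, `A' : Fin n → Set β`, and the member-wise UNION `unionEv (A i) (A' i) = {(a,b) | a ∈ A_i ∨ b ∈ A'_i}` and INTERSECTION
`interEv (A i) (A' i) = {(a,b) | a ∈ A_i ∧ b ∈ A'_i}` (in pattern-law terms: the law of `C ∪ C'`, resp. `C ∩ C'`, for independent `C ~ w`, `C' ~ w'`).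

* QUESTION (this seat gen 5): are member-wise unions / intersections of two INDEPENDENT all-orders-positive families all-orders positive?  For UNIONS the
  answer is NO from four members on (ttrl cp-mix 2026-08-20, MIXCOMB.md §7: an exact law of denominator 70 in `K_4` whose OR-mixture along two of four members —
  a union with an independent two-point family — has `E_4 < 0`; Lean replay in the companion refutation file of `…SahiMixtureLaw`), and OPEN for three members
  (exact census, cp-mix: every unordered pair of `K_3` grid laws of denominators 6–12, 16, 1.9·10⁹ convolved laws, 0 violations; this seat: grids 8/12/16 self-pairs,
  boundary pairs, random pairs, 0 violations).  For INTERSECTIONS the answer is NO already for three members: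
* **`exists_allOrders_inter_sahiE_three_neg` — THE INTERSECTION ANALOGUE IS FALSE**: the pattern law `w = (x_∅,x_0,x_1,x_{01},x_2,x_{02},x_{12},x_{012}) =
  (1/4, 0, 0, 1/4, 1/6, 1/12, 1/12, 1/6)` on `2^{[3]}` is all-orders positive (`Cov = (1/6, 0, 0)`, `E_3 = 0`: `A_2` independent of `A_0` and of `A_1`), but for an
  INDEPENDENT COPY `A'` of `A` the triple `(A_i ∩ A'_i)_i` has `E_3 = 2(1/6)² + (1/2)⁶ − 2·(1/2)²(1/4)² − (1/2)²(5/12)² = −1/288 < 0`.  So all-orders Sahi positivity is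
  preserved by intersecting with independent LITERAL families (`…SahiMixtureLawThree`, AND-mixtures; Sahi's Theorem 2) but NOT by member-wise intersection with an
  independent all-orders-positive family in general (first violations on the grid of denominator 12: 12 of 9 677 laws against themselves).  (The law `w` is not the
  pattern law of increasing events under a product measure — there `Cov = 0` forces disjoint supports — so this is no evidence about Sahi's `C_3`.)
* **`convolution_allOrders_iff_rows`** — by `allOrders_iff_squarefree` on the product space, all orders for a family of events of `α × β` ⟺ ONE inequality per order
  `k`: the top square-free rows (injective slot maps); so the union question for `n` members needs exactly `E_k(union family ∘ e) ≥ 0`, `e` injective, `2 ≤ k ≤ n`.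
* **`sahiE_two_unionEv_nonneg`, `sahiE_two_interEv_nonneg`, `convolutionClosure_two` — TWO EVENTS**: both the union and the intersection pair have
  `Cov ≥ 0` (`E(ā_0ā_1)E(ā'_0ā'_1) − E ā_0 E ā_1 E ā'_0 E ā'_1 ≥ 0`, resp. without bars), so over two members both closures hold at every order.
HONEST FRAMING: no positivity conjecture is asserted here; the three-member union question is open, everything else is settled above. [this work]
-/

noncomputable section

open scoped Classical

namespace Summit.CriticalPhenomena.PercolationContinuityZ3.Theorems

open Finset Function
open Literature.Combinatorics.Sahi2008
open Literature.Probability.Percolation.BHK2006 (ind_le_one)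
open Literature.Probability.Percolation.DecisionTree (ind ind_of_mem ind_of_not_mem ind_nonneg)

namespace SahiMixture

/-! ### Product weight, union and intersection events -/

section Prod

variable {α β : Type*} [Fintype α] [Fintype β]

/-- The product (independent coupling) of two weights. [folklore] -/
def prodWeight (μ : α → ℝ) (ν : β → ℝ) : α × β → ℝ := fun x => μ x.1 * ν x.2

/-- Member-wise union of an event of `α` and an event of `β`, as an event of `α × β`. [this work] -/
def unionEv (A : Set α) (A' : Set β) : Set (α × β) := {x | x.1 ∈ A ∨ x.2 ∈ A'}

/-- Member-wise intersection of an event of `α` and an event of `β`, as an event of `α × β`. [this work] -/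
def interEv (A : Set α) (A' : Set β) : Set (α × β) := {x | x.1 ∈ A ∧ x.2 ∈ A'}

/-- **Fubini for separable functions**: `E_{μ⊗ν}[f ⊗ g] = E_μ[f]·E_ν[g]`. [folklore] -/
theorem ex_prodWeight_sep (μ : α → ℝ) (ν : β → ℝ) (f : α → ℝ) (g : β → ℝ) :
    ex (prodWeight μ ν) (fun x => f x.1 * g x.2) = ex μ f * ex ν g := by
  simp only [ex_def, prodWeight, Fintype.sum_prod_type, Finset.sum_mul_sum]
  exact Finset.sum_congr rfl fun a _ => Finset.sum_congr rfl fun b _ => by ring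

omit [Fintype α] [Fintype β] in
/-- Indicator of a member-wise intersection. [this work] -/
theorem ind_interEv (A : Set α) (A' : Set β) (x : α × β) : ind (interEv A A') x = ind A x.1 * ind A' x.2 := by
  by_cases h1 : x.1 ∈ A <;> by_cases h2 : x.2 ∈ A' <;> simp [interEv, ind_of_mem, ind_of_not_mem, h1, h2]

omit [Fintype α] [Fintype β] in
/-- Indicator of a member-wise union: `1 − (1 − 1_A)(1 − 1_{A'})`. [this work] -/
theorem ind_unionEv (A : Set α) (A' : Set β) (x : α × β) : ind (unionEv A A') x = 1 - (1 - ind A x.1) * (1 - ind A' x.2) := by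
  by_cases h1 : x.1 ∈ A <;> by_cases h2 : x.2 ∈ A' <;> simp [unionEv, ind_of_mem, ind_of_not_mem, h1, h2]

omit [Fintype α] [Fintype β] in
/-- The product weight is nonnegative. [folklore] -/
theorem prodWeight_nonneg {μ : α → ℝ} {ν : β → ℝ} (hμ : ∀ a, 0 ≤ μ a) (hν : ∀ b, 0 ≤ ν b) (x : α × β) : 0 ≤ prodWeight μ ν x :=
  mul_nonneg (hμ _) (hν _)

/-- The product weight of probability weights has total mass `1`. [folklore] -/
theorem sum_prodWeight {μ : α → ℝ} {ν : β → ℝ} (hμ1 : ∑ a, μ a = 1) (hν1 : ∑ b, ν b = 1) : ∑ x, prodWeight μ ν x = 1 := by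
  have h := ex_prodWeight_sep μ ν (fun _ => 1) (fun _ => 1)
  simp only [mul_one, ex_def, hμ1, hν1] at h
  simpa using h

end Prod

/-! ### Reduction to one square-free row per order -/


/-- **Reduction to one square-free row per order.**  For any family `B` of events of the product space, all orders ⟺ for every `k` and every injective
`e : Fin k → Fin n`, `E_k(1_{B∘e}) ≥ 0`; in particular the convolution conjecture for `n` members needs exactly the top rows `E_k ≥ 0`, `2 ≤ k ≤ n`, of the convolved
sub-families (orders `k ≤ 1` are automatic). [this work] -/
theorem convolution_allOrders_iff_rows {α β : Type*} [Fintype α] [Fintype β] {μ : α → ℝ} {ν : β → ℝ} (hμ : ∀ a, 0 ≤ μ a) (hμ1 : ∑ a, μ a = 1)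
    (hν : ∀ b, 0 ≤ ν b) (hν1 : ∑ b, ν b = 1) {n : ℕ} (B : Fin n → Set (α × β)) :
    AllOrders (prodWeight μ ν) B ↔
      ∀ (k : ℕ) (e : Fin k → Fin n), Injective e → 2 ≤ k → 0 ≤ sahiE (prodWeight μ ν) k (fun j => ind (B (e j))) := by
  rw [allOrders_iff_squarefree (prodWeight_nonneg hμ hν) (sum_prodWeight hμ1 hν1)]
  refine ⟨fun h k e he _ => h k e he, fun h k e he => ?_⟩
  rcases Nat.lt_or_ge k 2 with hk | hk
  · interval_cases k
    · rw [sahiE_zero]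
    · rw [sahiE_one_apply]; exact ex_nonneg (prodWeight_nonneg hμ hν) (ind_nonneg _)
  · exact h k e he hk

/-! ### Two events: a theorem -/

/-- `E_w[1 − F] = 1 − E_w[F]` for a weight of total mass `1`. [folklore] -/
theorem ex_one_sub_fun {γ : Type*} [Fintype γ] {w : γ → ℝ} (hw1 : ∑ x, w x = 1) (F : γ → ℝ) :
    ex w (fun x => 1 - F x) = 1 - ex w F := by
  have e := ex_eq_lin w (fun x => 1 - F x) ![1, -1] ![fun _ => 1, F] (fun a => by simp [Fin.sum_univ_succ]; ring)
  simp only [Fin.sum_univ_succ, Fin.sum_univ_zero, Matrix.cons_val_zero, Matrix.cons_val_succ, ex_const hw1] at e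
  linarith

/-- `E[(1−f)(1−g)] = 1 − E f − E g + E(fg)` for a weight of total mass `1`. [folklore] -/
theorem ex_compl_mul_compl {γ : Type*} [Fintype γ] {w : γ → ℝ} (hw1 : ∑ x, w x = 1) (f g : γ → ℝ) :
    ex w (fun x => (1 - f x) * (1 - g x)) = 1 - ex w f - ex w g + ex w (f * g) := by
  have e := ex_eq_lin w (fun x => (1 - f x) * (1 - g x)) ![1, -1, -1, 1] ![fun _ => 1, f, g, f * g]
    (fun a => by simp [Fin.sum_univ_succ]; ring)
  simp only [Fin.sum_univ_succ, Fin.sum_univ_zero, Matrix.cons_val_zero, Matrix.cons_val_succ, ex_const hw1] at e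
  linarith

/-- Dispatch over the three increasing pairs of `Fin 3`. [folklore] -/
theorem forall_lt_three {P : Fin 3 → Fin 3 → Prop} (h01 : P 0 1) (h02 : P 0 2) (h12 : P 1 2) : ∀ i j : Fin 3, i < j → P i j := by
  intro i j hij
  fin_cases i <;> fin_cases j
  all_goals first | exact absurd hij (by decide) | exact h01 | exact h02 | exact h12

section Two

variable {α β : Type*} [Fintype α] [Fintype β] {μ : α → ℝ} {ν : β → ℝ}
  (hμ : ∀ a, 0 ≤ μ a) (hμ1 : ∑ a, μ a = 1) (hν : ∀ b, 0 ≤ ν b) (hν1 : ∑ b, ν b = 1)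
include hμ hμ1 hν hν1

omit hμ1 hν1 in
/-- `Cov` of a member-wise INTERSECTION pair: `E(a_0a_1)E(a'_0a'_1) − E a_0 E a_1 E a'_0 E a'_1 ≥ 0`. [this work] -/
theorem sahiE_two_interEv_nonneg (X Y : Set α) (X' Y' : Set β) (hXY : ex μ (ind X) * ex μ (ind Y) ≤ ex μ (ind X * ind Y))
    (hXY' : ex ν (ind X') * ex ν (ind Y') ≤ ex ν (ind X' * ind Y')) :
    0 ≤ sahiE (prodWeight μ ν) 2 ![ind (interEv X X'), ind (interEv Y Y')] := by
  have e1 : ex (prodWeight μ ν) (ind (interEv X X')) = ex μ (ind X) * ex ν (ind X') := by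
    rw [← ex_prodWeight_sep]; congr 1; funext x; exact ind_interEv X X' x
  have e2 : ex (prodWeight μ ν) (ind (interEv Y Y')) = ex μ (ind Y) * ex ν (ind Y') := by
    rw [← ex_prodWeight_sep]; congr 1; funext x; exact ind_interEv Y Y' x
  have e3 : ex (prodWeight μ ν) (ind (interEv X X') * ind (interEv Y Y')) = ex μ (ind X * ind Y) * ex ν (ind X' * ind Y') := by
    rw [← ex_prodWeight_sep]; congr 1; funext x; simp only [Pi.mul_apply, ind_interEv]; ring
  rw [sahiE_two, e1, e2, e3]
  have x0 : 0 ≤ ex μ (ind X) := ex_nonneg hμ (ind_nonneg _)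
  have y0 : 0 ≤ ex μ (ind Y) := ex_nonneg hμ (ind_nonneg _)
  have x0' : 0 ≤ ex ν (ind X') := ex_nonneg hν (ind_nonneg _)
  have y0' : 0 ≤ ex ν (ind Y') := ex_nonneg hν (ind_nonneg _)
  have h := mul_le_mul hXY hXY' (mul_nonneg x0' y0') (le_trans (mul_nonneg x0 y0) hXY)
  linarith

/-- `Cov` of a member-wise UNION pair: `E(ā_0ā_1)E(ā'_0ā'_1) − E ā_0 E ā_1 E ā'_0 E ā'_1 ≥ 0`. [this work] -/
theorem sahiE_two_unionEv_nonneg (X Y : Set α) (X' Y' : Set β) (hXY : ex μ (ind X) * ex μ (ind Y) ≤ ex μ (ind X * ind Y))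
    (hXY' : ex ν (ind X') * ex ν (ind Y') ≤ ex ν (ind X' * ind Y')) :
    0 ≤ sahiE (prodWeight μ ν) 2 ![ind (unionEv X X'), ind (unionEv Y Y')] := by
  have hP1 := sum_prodWeight (μ := μ) (ν := ν) hμ1 hν1
  -- complement moments on each factor
  have x1 : ex μ (ind X) ≤ 1 := (ex_mono hμ (ind_le_one X)).trans_eq (ex_one hμ1)
  have y1 : ex μ (ind Y) ≤ 1 := (ex_mono hμ (ind_le_one Y)).trans_eq (ex_one hμ1)
  have x1' : ex ν (ind X') ≤ 1 := (ex_mono hν (ind_le_one X')).trans_eq (ex_one hν1)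
  have y1' : ex ν (ind Y') ≤ 1 := (ex_mono hν (ind_le_one Y')).trans_eq (ex_one hν1)
  have cXY := ex_compl_mul_compl hμ1 (ind X) (ind Y)
  have cXY' := ex_compl_mul_compl hν1 (ind X') (ind Y')
  have cX := ex_one_sub_fun hμ1 (ind X)
  have cY := ex_one_sub_fun hμ1 (ind Y)
  have cX' := ex_one_sub_fun hν1 (ind X')
  have cY' := ex_one_sub_fun hν1 (ind Y')
  -- moments on the product space
  have e1 : ex (prodWeight μ ν) (ind (unionEv X X')) = 1 - ex μ (fun a => 1 - ind X a) * ex ν (fun b => 1 - ind X' b) := by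
    rw [show ind (unionEv X X') = fun x => 1 - (fun x : α × β => (1 - ind X x.1) * (1 - ind X' x.2)) x from funext (ind_unionEv X X'),
      ex_one_sub_fun hP1, ex_prodWeight_sep μ ν (fun a => 1 - ind X a) (fun b => 1 - ind X' b)]
  have e2 : ex (prodWeight μ ν) (ind (unionEv Y Y')) = 1 - ex μ (fun a => 1 - ind Y a) * ex ν (fun b => 1 - ind Y' b) := by
    rw [show ind (unionEv Y Y') = fun x => 1 - (fun x : α × β => (1 - ind Y x.1) * (1 - ind Y' x.2)) x from funext (ind_unionEv Y Y'),
      ex_one_sub_fun hP1, ex_prodWeight_sep μ ν (fun a => 1 - ind Y a) (fun b => 1 - ind Y' b)]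
  have e3 : ex (prodWeight μ ν) (ind (unionEv X X') * ind (unionEv Y Y'))
      = 1 - ex μ (fun a => 1 - ind X a) * ex ν (fun b => 1 - ind X' b) - ex μ (fun a => 1 - ind Y a) * ex ν (fun b => 1 - ind Y' b)
        + ex μ (fun a => (1 - ind X a) * (1 - ind Y a)) * ex ν (fun b => (1 - ind X' b) * (1 - ind Y' b)) := by
    have hpt : ind (unionEv X X') * ind (unionEv Y Y')
        = fun x => (1 - (fun x : α × β => (1 - ind X x.1) * (1 - ind X' x.2)) x) * (1 - (fun x : α × β => (1 - ind Y x.1) * (1 - ind Y' x.2)) x) := by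
      funext x; simp only [Pi.mul_apply, ind_unionEv]
    rw [hpt, ex_compl_mul_compl hP1, ex_prodWeight_sep μ ν (fun a => 1 - ind X a) (fun b => 1 - ind X' b),
      ex_prodWeight_sep μ ν (fun a => 1 - ind Y a) (fun b => 1 - ind Y' b)]
    have hfg : ((fun x : α × β => (1 - ind X x.1) * (1 - ind X' x.2)) * fun x : α × β => (1 - ind Y x.1) * (1 - ind Y' x.2))
        = fun x : α × β => ((1 - ind X x.1) * (1 - ind Y x.1)) * ((1 - ind X' x.2) * (1 - ind Y' x.2)) := by
      funext x; simp only [Pi.mul_apply]; ring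
    rw [hfg, ex_prodWeight_sep μ ν (fun a => (1 - ind X a) * (1 - ind Y a)) (fun b => (1 - ind X' b) * (1 - ind Y' b))]
  rw [sahiE_two, e1, e2, e3, cXY, cXY', cX, cY, cX', cY']
  -- `q ≥ p·p'` on each factor, everything in `[0,1]`
  have hq : (1 - ex μ (ind X)) * (1 - ex μ (ind Y)) ≤ 1 - ex μ (ind X) - ex μ (ind Y) + ex μ (ind X * ind Y) := by nlinarith
  have hq' : (1 - ex ν (ind X')) * (1 - ex ν (ind Y')) ≤ 1 - ex ν (ind X') - ex ν (ind Y') + ex ν (ind X' * ind Y') := by nlinarith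
  have hp : 0 ≤ (1 - ex μ (ind X)) * (1 - ex μ (ind Y)) := mul_nonneg (sub_nonneg.2 x1) (sub_nonneg.2 y1)
  have hp' : 0 ≤ (1 - ex ν (ind X')) * (1 - ex ν (ind Y')) := mul_nonneg (sub_nonneg.2 x1') (sub_nonneg.2 y1')
  have h := mul_le_mul hq hq' hp' (le_trans hp hq)
  nlinarith [h, hp, hp']

/-- **TWO EVENTS: both closures hold.**  If `Cov(A_0,A_1) ≥ 0` under `μ` and `Cov(A'_0,A'_1) ≥ 0` under `ν` (all that `AllOrders` says over two events), the member-wise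
union AND the member-wise intersection families on `α × β` are Sahi-nonnegative at every order. [this work] -/
theorem convolutionClosure_two (A : Fin 2 → Set α) (A' : Fin 2 → Set β) (hA : AllOrders μ A) (hA' : AllOrders ν A') :
    AllOrders (prodWeight μ ν) (fun i => unionEv (A i) (A' i)) ∧ AllOrders (prodWeight μ ν) (fun i => interEv (A i) (A' i)) := by
  have hcov : ∀ i j : Fin 2, ex μ (ind (A i)) * ex μ (ind (A j)) ≤ ex μ (ind (A i) * ind (A j)) := fun i j => by
    have h := hA 2 ![i, j]
    rw [sahiE_two_apply] at h
    simp only [Matrix.cons_val_zero, Matrix.cons_val_one] at h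
    linarith
  have hcov' : ∀ i j : Fin 2, ex ν (ind (A' i)) * ex ν (ind (A' j)) ≤ ex ν (ind (A' i) * ind (A' j)) := fun i j => by
    have h := hA' 2 ![i, j]
    rw [sahiE_two_apply] at h
    simp only [Matrix.cons_val_zero, Matrix.cons_val_one] at h
    linarith
  have two : ∀ (k : ℕ) (e : Fin k → Fin 2), Injective e → 2 ≤ k → k = 2 := fun k e he hk =>
    le_antisymm (by simpa using Fintype.card_le_of_injective e he) hk
  constructor
  · refine (convolution_allOrders_iff_rows hμ hμ1 hν hν1 _).2 fun k e he hk => ?_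
    obtain rfl := two k e he hk
    have h := sahiE_two_unionEv_nonneg hμ hμ1 hν hν1 (A (e 0)) (A (e 1)) (A' (e 0)) (A' (e 1)) (hcov _ _) (hcov' _ _)
    have ee : (fun j => ind (unionEv (A (e j)) (A' (e j)))) = ![ind (unionEv (A (e 0)) (A' (e 0))), ind (unionEv (A (e 1)) (A' (e 1)))] :=
      funext fun j => by fin_cases j <;> rfl
    rwa [ee]
  · refine (convolution_allOrders_iff_rows hμ hμ1 hν hν1 _).2 fun k e he hk => ?_
    obtain rfl := two k e he hk
    have h := sahiE_two_interEv_nonneg hμ hν (A (e 0)) (A (e 1)) (A' (e 0)) (A' (e 1)) (hcov _ _) (hcov' _ _)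
    have ee : (fun j => ind (interEv (A (e j)) (A' (e j)))) = ![ind (interEv (A (e 0)) (A' (e 0))), ind (interEv (A (e 1)) (A' (e 1)))] :=
      funext fun j => by fin_cases j <;> rfl
    rwa [ee]

end Two

/-! ### The intersection analogue is false: an exact counterexample over three events -/

section Counterexample

/-- The weights of the counterexample law on the eight Venn cells of three events, indexed by the bitmask `C ∈ {0,…,7}` (bit `i` ↔ membership in
`A_i`): `(x_∅, x_0, x_1, x_{01}, x_2, x_{02}, x_{12}, x_{012}) = (1/4, 0, 0, 1/4, 1/6, 1/12, 1/12, 1/6)`. [this work] -/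
def cexWeight : Fin 8 → ℝ := ![1/4, 0, 0, 1/4, 1/6, 1/12, 1/12, 1/6]

/-- The three events of the counterexample: `A_i` = the cells whose bitmask has bit `i`. [this work] -/
def cexEvent : Fin 3 → Set (Fin 8) :=
  ![{c | c = 1 ∨ c = 3 ∨ c = 5 ∨ c = 7}, {c | c = 2 ∨ c = 3 ∨ c = 6 ∨ c = 7}, {c | c = 4 ∨ c = 5 ∨ c = 6 ∨ c = 7}]

/-- Indicator vectors of the three events. [this work] -/
theorem ind_cexEvent_zero : ind (cexEvent 0) = ![0, 1, 0, 1, 0, 1, 0, 1] := by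
  funext c; fin_cases c <;> simp [cexEvent, ind_of_mem, ind_of_not_mem]

/-- Indicator vectors of the three events. [this work] -/
theorem ind_cexEvent_one : ind (cexEvent 1) = ![0, 0, 1, 1, 0, 0, 1, 1] := by
  funext c; fin_cases c <;> simp [cexEvent, ind_of_mem, ind_of_not_mem]

/-- Indicator vectors of the three events. [this work] -/
theorem ind_cexEvent_two : ind (cexEvent 2) = ![0, 0, 0, 0, 1, 1, 1, 1] := by
  funext c; fin_cases c <;> simp [cexEvent, ind_of_mem, ind_of_not_mem]

/-- The counterexample weight is a probability weight. [this work] -/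
theorem cexWeight_nonneg (c : Fin 8) : 0 ≤ cexWeight c := by
  fin_cases c <;> simp [cexWeight]

/-- The counterexample weight is a probability weight. [this work] -/
theorem sum_cexWeight : ∑ c, cexWeight c = 1 := by
  simp [cexWeight, Fin.sum_univ_succ]; norm_num

/-- The seven moments: `M_0 = M_1 = M_2 = 1/2`, `M_{01} = 5/12`, `M_{02} = M_{12} = 1/4`, `M_{012} = 1/6`. [this work] -/
theorem cex_moments :
    ex cexWeight (ind (cexEvent 0)) = 1/2 ∧ ex cexWeight (ind (cexEvent 1)) = 1/2 ∧ ex cexWeight (ind (cexEvent 2)) = 1/2 ∧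
    ex cexWeight (ind (cexEvent 0) * ind (cexEvent 1)) = 5/12 ∧ ex cexWeight (ind (cexEvent 0) * ind (cexEvent 2)) = 1/4 ∧
    ex cexWeight (ind (cexEvent 1) * ind (cexEvent 2)) = 1/4 ∧ ex cexWeight (ind (cexEvent 0) * ind (cexEvent 1) * ind (cexEvent 2)) = 1/6 := by
  simp only [ex_def, ind_cexEvent_zero, ind_cexEvent_one, ind_cexEvent_two, cexWeight, Fin.sum_univ_succ, Fin.sum_univ_zero, Pi.mul_apply]
  simp; norm_num

/-- The counterexample triple is Sahi-nonnegative at EVERY order (`Cov = (1/6, 0, 0)`, `E_3 = 0`). [this work] -/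
theorem allOrders_cex : AllOrders cexWeight cexEvent := by
  obtain ⟨m0, m1, m2, m01, m02, m12, m012⟩ := cex_moments
  refine allOrders_three_of_rows cexWeight_nonneg sum_cexWeight cexEvent (forall_lt_three ?_ ?_ ?_) ?_
  · rw [m0, m1, m01]; norm_num
  · rw [m0, m2, m02]; norm_num
  · rw [m1, m2, m12]; norm_num
  · rw [sahiE_three, m0, m1, m2, m01, m02, m12, m012]; norm_num

/-- **Closure under intersection with an independent family is FALSE**: for the all-orders-positive triple `cexEvent` under `cexWeight` and an INDEPENDENT copy of it,
the member-wise intersections have `E_3 = −1/288`. [this work] -/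
theorem sahiE_three_inter_cex :
    sahiE (prodWeight cexWeight cexWeight) 3 (fun j => ind (interEv (cexEvent j) (cexEvent j))) = -1/288 := by
  obtain ⟨m0, m1, m2, m01, m02, m12, m012⟩ := cex_moments
  have e : (fun j => ind (interEv (cexEvent j) (cexEvent j)))
      = ![ind (interEv (cexEvent 0) (cexEvent 0)), ind (interEv (cexEvent 1) (cexEvent 1)), ind (interEv (cexEvent 2) (cexEvent 2))] :=
    funext fun j => by fin_cases j <;> rfl
  -- every moment of the intersection family is the SQUARE of the corresponding moment of the factor
  have sq1 : ∀ i : Fin 3, ex (prodWeight cexWeight cexWeight) (ind (interEv (cexEvent i) (cexEvent i)))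
      = ex cexWeight (ind (cexEvent i)) * ex cexWeight (ind (cexEvent i)) := fun i => by
    rw [← ex_prodWeight_sep]; congr 1; funext x; exact ind_interEv _ _ x
  have sq2 : ∀ i j : Fin 3, ex (prodWeight cexWeight cexWeight) (ind (interEv (cexEvent i) (cexEvent i)) * ind (interEv (cexEvent j) (cexEvent j)))
      = ex cexWeight (ind (cexEvent i) * ind (cexEvent j)) * ex cexWeight (ind (cexEvent i) * ind (cexEvent j)) := fun i j => by
    rw [← ex_prodWeight_sep]; congr 1; funext x; simp only [Pi.mul_apply, ind_interEv]; ring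
  have sq3 : ex (prodWeight cexWeight cexWeight)
      (ind (interEv (cexEvent 0) (cexEvent 0)) * ind (interEv (cexEvent 1) (cexEvent 1)) * ind (interEv (cexEvent 2) (cexEvent 2)))
      = ex cexWeight (ind (cexEvent 0) * ind (cexEvent 1) * ind (cexEvent 2)) * ex cexWeight (ind (cexEvent 0) * ind (cexEvent 1) * ind (cexEvent 2)) := by
    rw [← ex_prodWeight_sep]; congr 1; funext x; simp only [Pi.mul_apply, ind_interEv]; ring
  rw [e, sahiE_three, sq1, sq1, sq1, sq2, sq2, sq2, sq3, m0, m1, m2, m01, m02, m12, m012]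
  norm_num

/-- **All-orders Sahi positivity is NOT closed under member-wise intersection with an independent all-orders-positive family** (contrast: it is closed
under intersection with independent literal/coin families — the AND-mixtures of `…SahiMixtureLawThree`). [this work] -/
theorem exists_allOrders_inter_sahiE_three_neg :
    ∃ (μ : Fin 8 → ℝ) (A : Fin 3 → Set (Fin 8)), (∀ a, 0 ≤ μ a) ∧ ∑ a, μ a = 1 ∧ AllOrders μ A ∧
      sahiE (prodWeight μ μ) 3 (fun j => ind (interEv (A j) (A j))) < 0 :=
  ⟨cexWeight, cexEvent, cexWeight_nonneg, sum_cexWeight, allOrders_cex, by rw [sahiE_three_inter_cex]; norm_num⟩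

/-- Closure of all-orders Sahi positivity under member-wise INTERSECTION with an independent all-orders-positive family, stated for the record — it is FALSE
(`not_interClosure`). [this work] -/
def InterClosure : Prop :=
  ∀ (α β : Type) [Fintype α] [Fintype β] (μ : α → ℝ) (ν : β → ℝ), (∀ a, 0 ≤ μ a) → ∑ a, μ a = 1 → (∀ b, 0 ≤ ν b) → ∑ b, ν b = 1 →
    ∀ (n : ℕ) (A : Fin n → Set α) (A' : Fin n → Set β), AllOrders μ A → AllOrders ν A' →
      AllOrders (prodWeight μ ν) (fun i => interEv (A i) (A' i))

/-- **Refutation of the intersection-convolution closure.** [this work] -/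
theorem not_interClosure : ¬ InterClosure := by
  intro h
  have hall := h (Fin 8) (Fin 8) cexWeight cexWeight cexWeight_nonneg sum_cexWeight cexWeight_nonneg sum_cexWeight 3 cexEvent cexEvent
    allOrders_cex allOrders_cex 3 id
  have hneg : sahiE (prodWeight cexWeight cexWeight) 3 (fun j => ind (interEv (cexEvent (id j)) (cexEvent (id j)))) < 0 := by
    rw [show (fun j => ind (interEv (cexEvent (id j)) (cexEvent (id j)))) = fun j => ind (interEv (cexEvent j) (cexEvent j)) from rfl,
      sahiE_three_inter_cex]
    norm_num
  linarith

end Counterexample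

end SahiMixture

end Summit.CriticalPhenomena.PercolationContinuityZ3.Theorems

end
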